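import Literature.Computability.AlgebraicComplexity.Polystability
import Literature.Computability.AlgebraicComplexity.OrbitClosureProofs
import Literature.Computability.AlgebraicComplexity.CharacterizedByStabilizerSL
import Literature.Computability.AlgebraicComplexity.EquivariantDC
import Literature.Computability.AlgebraicComplexity.CapabilityBound
import Literature.RepresentationTheory.GeneralLinear.SchurFunctor
import Literature.NumberTheory.DiophantineGeometry.DetOrbitSymKroneckerBound
import Literature.RingTheory.SymmetricFunctions.SchurPolynomials
import HarnessLib

/-!
# BLMW 2011 §4–§7 as printed: stability of orbits, the symmetric Kronecker description of the
# orbit rings of `det_n`, `per_m`, `ℓ^{n-m} per_m`, admissibility, `Sub` and `F_s` (typed literature)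

P. Bürgisser, J. M. Landsberg, L. Manivel, J. Weyman, *An overview of mathematical issues arising
in the geometric complexity theory approach to `VP ≠ VNP`*, SIAM J. Comput. **40**(4) (2011)
1179–1209 = arXiv:0907.2850**v2** [BurgisserEtAl2011], §4 "Stabilizers and coordinate rings of
orbits", §5 "Examples", §6 "Inheritance theorems and desingularizations", §7 "Orbits and their
closures". Cell `val-lit` (D-0074 GROUP L), row `BLMW11-A` of `run/shared/lean/pub/val-lit/DAG.tsv`;
typed literature only — **`VP ≠ VNP` is not proved and nothing here is progress on it**.

**Version of record.** The printed (SIAM) numbering is that of arXiv v2 (`\numberwithin{theorem}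
{subsection}`: Prop. 4.4.1, Def. 4.5.1, …); the held corpus text `paper:arxiv-0907.2850`
(chunks `p0007`–`p0016` for §4–§7) is arXiv **v1**, whose numbering is sequential (Prop. 4.1,
Def. 4.2, …) and whose §5 differs in CONTENT: v1 states Props. 5.1/5.3 with plain Kronecker
coefficients, v2 (= print) corrects them to SYMMETRIC Kronecker coefficients `sk^π_{μμ}` (5.2.5),
and v1's Thm. 5.7 ("the GCT program" via vanishing `k_{δⁿ,δⁿ,π}`) and Question 7.1
(`\overline{GL·det_n} = End·det_n`?) are REMOVED in print (the latter answered negatively,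
Landsberg–Manivel–Ressayre 2013, Prop. 3.5.1). Every locator below is "v2 number (v1 = held chunk
number)".

## Dictionary print ↔ tree

`W` = the span of the variables `x_σ` (= `k^σ`, BLMW's `W = Mat^*_{n×n}` for `σ = MatIdx n`),
`V = S^dW` = forms of degree `d` in `k[x_σ]`, `G = GL(W) = GL σ k` acting on `W` by the standard
representation (`stdRep σ k`, `g · e_i = g *ᵥ e_i`) and on forms by linear substitution
(`linSubstRep`, `X_i ↦ ∑_j g_{ji} X_j` — the SAME convention), `GL(W)(v)` = `linStabilizer v`,
`GL(W)·v` = `glOrbit`, `SL(W)·v` = `slOrbit`, `SL(W)` = `slSubgroup`, `\overline{GL(W)·v}` = the tree's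
affine `orbitClosure` (Zariski), `ℂ[\overline{GL(W)·v}]_δ ⊂ S^δ(S^dW^*)` = `orbitCoordRingDeg v d δ`
with `S_πW^* ⊂ ℂ[\overline{GL(W)·v}]` ⟺ `HasHighestWeight (orbitCoordRep v d) (dualOfPartition π)`
and multiplicity `orbitMultiplicity k v d (dualOfPartition π)` (`SchurWeylPlethysm.lean`),
`S_πW` = `schurRep (stdRep σ k) π` (`SchurFunctor.lean`), `[π]` = `spechtRep k π`,
`k_{πμν} = dim Hom_{𝔖_d}([π], [μ] ⊗ [ν])` (5.2.3) = `kroneckerCoeff k μ ν π`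
(`= dim Hom([μ] ⊗ [ν], [π])`; equal in characteristic zero, where also fully symmetric),
`p_μ = mult(S_μE, S^m(S^δE))` (§5.5) = `plethysmCoeffOfPartition k m δ μ`.

## Contents (print item → declaration → status)

* §4.3 "`v` is `G`-stable if `G·v` is closed" (Kempf) → `subgroupOrbit`, `IsStableUnder`
  (definitions); for `G = SL(W)` this IS the tree's `IsPolystable` (`isStableUnder_slSubgroup_iff`,
  proved); `[det_n]`, `per_m` are `SL(W)`-stable (§5.2, §5.5, Kempf's criterion) → CITE
  `BurgisserIkenmeyer2017_polystable_det_per` (`Polystability.lean`).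
* §4.4 first paragraph "if the homotheties act non-trivially on `v` then `GL(W)·v` is never
  stable, as it contains the origin in its closure" → `zero_mem_orbitClosure_of_isHomogeneous`,
  `zero_notMem_glOrbit`, `not_isStableUnder_top` (PROVED, forms of positive degree).
* §4.1 (4.1.2) `ℂ[G/H] = ⊕_λ (V_λ^*)^{⊕ dim V_λ^H}` → the invariant space `subgroupInvariants ρ H`
  (definition; the decomposition itself — Frobenius reciprocity for `ℂ[G]`, Kraft II.3.3 — is not
  restated); Def. 6.1.3 "`M` is `H`-admissible if `M^H ≠ 0`" → `IsAdmissible`.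
* Prop. 4.5.4 (Pieri, `S_π(A ⊕ A') = ⊕_{π ↦ π'} S_{π'}A ⊗ S^{|π|-|π'|}A'`) → the relation `π ↦ π'`
  is `Nat.Partition.Interlaces` (what Defs. 5.6.1 consume; the tree's `IsHorizStripOver`,
  `CapabilityBound.lean`, is the same relation on dual weights), and the decomposition itself is
  vendored at the level of CHARACTERS — the branching rule for Schur polynomials
  `s_π(x, y) = ∑_{π ↦ π'} s_{π'}(x) y^{|π|-|π'|}` — as the named fact `BLMW2011_prop_4_5_4_character`
  (last section; the tree's `SymmPoly.schur`).
* (5.2.5) `sk^π_{μμ} := dim Hom_{𝔖_d}([π], Sym²[μ])`, "`sk^π_{μμ} ≤ k_{πμμ}`" →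
  `symKroneckerCoeff` (definition, general `μ`; the tree's `symKroneckerCoeffRect` is the
  rectangular case `μ = δⁿ` through a different (bound-space) construction) and the named fact
  `BLMW2011_symKroneckerCoeff_le`.
* Prop. 5.2.1: (5.2.7) `ℂ[\overline{GL(W)·det_n}]_δ ⊆ ⊕_{|π|=nδ} (S_πW^*)^{⊕ sk^π_{δⁿδⁿ}}` is PROVED in
  the tree as `orbitMultiplicity_det_le_symKroneckerCoeffRect` (`DetOrbitSymKroneckerBound.lean`)
  — CITED, not restated; (5.2.6) `ℂ[GL(W)·det_n] = ⊕_δ ⊕_{|π|=nδ} (S_πW^*)^{⊕ sk^π_{δⁿδⁿ}}`, i.e.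
  (by (4.1.2)) the sentence of its proof "`dim (S_π(E ⊗ F))^H = sk^π_{δⁿδⁿ}` … if `n` does not
  divide `|π|` then `(S_π(E ⊗ F))^{H₀} = 0`" → named fact `BLMW2011_prop_5_2_1_invariants`.
* Def. 5.5.1 (`Σ_{per_m}`, `mult_π`) → `BLMW2011.MemSigmaPer`, `BLMW2011.multPerTwice` /
  `BLMW2011.multPerPrinted` (the printed formula), `BLMW2011.multPerOmitted`, `BLMW2011.multPer`
  (the printed formula PLUS the summand omitted in print — see the ERRATUM below); Prop. 5.5.2
  (5.5.2)/(5.5.3) → named facts `BLMW2011_prop_5_5_2_invariants` (orbit ring via (4.1.2)) and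
  `BLMW2011_prop_5_5_2_closure` (the inclusion for `ℂ[\overline{GL(W)·per_m}]_δ`, in
  `orbitMultiplicity` form), both with the corrected `mult_π` and in positive degree `δ` (A19).
* Def. 5.6.1 (`Σ^n_{per_m}`, `mult^n_π`) → `BLMW2011.MemSigmaPerPadded`, `BLMW2011.multPerPadded`;
  Prop. 5.6.2 (5.6.2) → named fact `BLMW2011_prop_5_6_2_closure` (corrected `mult_π` inside, `0 < δ`).

**ERRATUM (Def. 5.5.1 / Prop. 5.5.2, hence Prop. 5.6.2; val-lit t03 g3, 2026-08-26; evidence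
`run/shared/lean/pub/val-lit/bip/evidence/t03g3-BLMW11-Prop552/`).** The printed proof of
Prop. 5.5.2 states (arXiv v2 TeX `BLMWfinal.tex` L1190–1193) "`(X_μ ⊗ X_μ ⊗ K^π_{μμ})^τ =
Sym²(X_μ) ⊗ (K^π_{μμ})^τ`", `X_μ = (S_μE)_0^{𝔚_E}` (`dim X_μ = p_μ`). By the paper's own
(le:tau-action) `τ·((α ⊗ β) ∘ γ) = (β ⊗ α) ∘ σ^π_{μν}(γ)` the involution `τ` acts on
`X_μ ⊗ X_μ ⊗ K^π_{μμ}` as `swap ⊗ σ^π_{μμ}`, whose fixed space is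
`Sym²(X_μ) ⊗ (K^π_{μμ})^{+} ⊕ Λ²(X_μ) ⊗ (K^π_{μμ})^{-}`, with `dim (K^π_{μμ})^{+} = sk^π_{μμ}`
and `dim (K^π_{μμ})^{-} = k_{πμμ} - sk^π_{μμ}` (`= dim Hom_{𝔖_d}([π], Λ²[μ])`). The second summand,
of dimension `C(p_μ, 2)·(k_{πμμ} - sk^π_{μμ})`, is omitted in print, so the printed
`mult_π = ½ ∑_{μ≠ν} k_{πμν} p_μ p_ν + ∑_μ sk^π_{μμ} C(p_μ+1, 2)` UNDER-counts
`dim S_π(W)^{GL(W)(per_m)}` by `∑_μ C(p_μ, 2)(k_{πμμ} - sk^π_{μμ})` whenever some `p_μ ≥ 2` and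
`[π] ⊂ Λ²[μ]` — e.g. `m = 3`, `δ = 6` (`p_{(12,6)} = mult(S_{(12,6)}ℂ³, S³(S⁶ℂ³)) = 2`),
`π = (16,1,1)`: printed `71`, proof's dimension `72`; `m = 5`, `δ = 3` (`p_{(9,4,2)} = 2`),
`π = (13,1,1)`: `k = 4`, `sk = 1`, printed `253` vs `256` (exact integer arithmetic, two
independent methods each; not kernel-certified). Consequently (5.5.2) is false as printed in these
instances (granted the paper's own set-up (eq:SWmorph), (le:tau-action), (5.5.1)), and the
closure bounds (5.5.3), (5.6.2) are not established by the printed argument with the printed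
`mult_π`. This file therefore renders `BLMW2011.multPer` as the CORRECTED count (printed formula
`BLMW2011.multPerPrinted` plus `BLMW2011.multPerOmitted`): with it the three named facts are
exactly what the printed proofs establish ("AS PROVED"); their wording is otherwise verbatim.
The first landing of this file (p417934) carried the printed `mult_π`.

**ERRATUM A19 (typed side — a degree-`0` junk value of the tree's rendering, NOT a print erratum;
val-lit t08 g3 / t03 g4, 2026-08-26; certificate `BLMW11PerOrbitDegreeZero.lean`).** The three named
facts `BLMW2011_prop_5_5_2_invariants` (first conjunct), `BLMW2011_prop_5_5_2_closure`,
`BLMW2011_prop_5_6_2_closure` were first typed (p417934 … p431686) for EVERY degree `δ : ℕ`. At `δ = 0`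
the print is consistent (`π = ∅`, `p_∅ = dim (S_∅E)_0^{𝔚_E} = 1`, `mult_∅ = sk^∅_{∅∅}·C(2,2) = 1` = the
multiplicity of the constants), but the tree renders `p_μ` by `plethysmCoeffOfPartition ℂ m δ μ`, whose
value at inner degree `δ = 0` is the documented `Module.finrank` junk `0` (`SchurWeylPlethysm.lean`:
`k[Sym^0] = k[X]` with the trivial action; `BLMW11PerOrbitDegreeZero.lean`: `multPer_zero_eq_zero`,
`multPerPadded_zero_eq_zero`), so the typed right-hand sides `BLMW2011.multPer ℂ m 0 ∅`,
`BLMW2011.multPerPadded ℂ m n 0 ∅` are `0` while the left-hand sides are `1` (`S_∅W = ℂ` is invariant;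
the constants occur in every orbit-closure ring: `perOrbitCeiling_zero_pos`,
`not_unguarded_per_invariants_formula`, `not_unguarded_per_closure_bound`). AS TYPED before this
revision the three sentences were therefore false at `δ = 0`; AS CORRECTED they carry the guard `0 < δ`
(inserted right after `3 ≤ m →`, resp. `m < n →`), exactly as `BLMW2011_cor_8_4_2` and `DIP20_lem_3_4` do
for the same junk value. No other wording changed; nothing in the tree consumed a `δ = 0` instance.
* Prop. 6.3.2 (inheritance `W' ⊂ W`) is PROVED in the tree (`orbitMultiplicity_rename_extend`,
  `OrbitClosureInheritance.lean`) = Thm. 6.1.5(1) for `K = GL(W') × GL(W'')` (Remark 6.3.3), and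
  Thm. 4.5.5(1), first sentence, is its occurrence form `hasHighestWeight_orbitCoordRep_rename_extend_iff`
  — CITED. §6.3 `Sub_a(S^dW)` and Prop. 6.3.1(1) (ideal of the subspace variety = span of the
  `S_πW^*` with `ℓ(π) > a`): the ideal is the tree's `subVanishingIdeal`, the half "`ℓ(π) > a` ⇒
  in the ideal" is PROVED there (`highestWeightSpace_le_subVanishingIdeal`); the other half is the
  named fact `BLMW2011_prop_6_3_1_i_inf_eq_bot` here; the set `Sub_a` itself → `subspaceVariety`.
* §6.4 `F_s(S^dW) = {ℓ^s g}` → `linearPowerMultiples` (definition), `X_t^s·g`'s orbit lies in it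
  (`glOrbit_X_pow_mul_subset_linearPowerMultiples`, proved), "the closed subvariety `F_s(S^dW)`"
  → named fact `BLMW2011_linearPowerMultiples_closed`, whence
  `orbitClosure_X_pow_mul_subset_linearPowerMultiples` (proved from the fact):
  "`\overline{GL(W)·ℓ^{n-m} per_m}` … is contained in `F_{n-m}(S^nW)`".

## NOT typed here (and why) — recorded for `GAP-LEDGER`

* Prop. 4.4.1 (an irreducible `SL(W)`-module appears in `ℂ[SL(W)·v]` iff in some
  `ℂ[\overline{GL(W)·v}]_δ`), Thm. 4.5.5 (2)(3), Prop. 5.6.3, Def. 4.5.1 (`(R,P)`-stability),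
  Def. 6.1.1 ("lies over"), Thms. 6.1.4–6.1.5 ([MS2] Thms. 8.1–8.2): need the coordinate ring of a
  closed `SL`-orbit / of a projective `K`-orbit closure as a module with highest-weight theory for
  `SL(A)` and Levi subgroups, parabolic subgroups and Kempf's theory — absent from Mathlib and the
  tree (cf. `CharacterizedByStabilizer.lean`: "partial stability needs Kempf's destabilizing flag,
  absent from the tree"). Only their `GL(W') × GL(W'')` shadow (Prop. 6.3.2) is in the tree.
* (5.2.8), (5.5.4) (the `SL(W)`-orbit rings) — same reason; (5.2.1)/(5.5.1) (the stabilizers of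
  `det_n`, `per_m`) are the tree's `frobenius_detPreserver_unimodular_sandwich`
  (`DetStabilizerFrobenius.lean`, named fact) and `marcusMay1962_perPreserver_sandwich`
  (`PerStabilizerMarcusMay.lean`, proved) — CITED; (5.6.1) (stabilizer of `ℓ^{n-m}per_m`) not typed.
* §5.1, §5.3, §5.4 (generic forms): "generic" has no tree rendering.
* Thm. 6.2.1 (Weyman's geometric method: sheaf cohomology of `S^δη` on `G/P`), Prop. 6.3.1 (2)(3)
  (generators by minors of the flattening; normality, Cohen–Macaulay, rational singularities),
  §6.4 normalisation `Nor(ℂ[F_s])_e = S^{es}W^* ⊗ S^e(S^{d-s}W^*)` and non-normality of `F_s`,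
  Problem 6.4.1 (a problem, not a statement), §4.2/§7.4 (boundary of `G·v` has pure codimension
  one for reductive `G(v)`; valuations along boundary divisors; Kumar's non-normality of
  `\overline{GL·det_n}`, `\overline{GL·per_m}`), Question 7.2.1 (irreducible components of the
  boundary), §7.2 (weighted-graph construction): no sheaf cohomology / normality-of-varieties /
  irreducible-component vocabulary for these affine cones in the tree.

## References

* [BurgisserEtAl2011] BLMW, SIAM J. Comput. 40(4) (2011) 1179–1209, doi:10.1137/090765328,
  = arXiv:0907.2850v2: §4.3, §4.4, Prop. 4.4.1, Def. 4.5.1, Prop. 4.5.4, Thm. 4.5.5, §5.2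
  (5.2.3)–(5.2.7) Prop. 5.2.1, §5.5 Def. 5.5.1 Prop. 5.5.2, §5.6 Def. 5.6.1 Props. 5.6.2–5.6.3,
  §6.1 Def. 6.1.3, §6.3 Props. 6.3.1–6.3.2, §6.4.
* [Kempf1978] G. Kempf, *Instability in invariant theory*, Ann. Math. 108 (1978), Cor. 5.1.
* [MulmuleySohoniGCT2SIAM2008] K. Mulmuley, M. Sohoni, GCT II, SIAM J. Comput. 38 (2008),
  Thms. 8.1–8.2 (as BLMW Thms. 6.1.4–6.1.5).
* [BurgisserIkenmeyer2017] (tree: `Polystability.lean`), [FultonHarrisGTM129] §4, §6.1, §15.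
-/

noncomputable section

open MvPolynomial

namespace Literature.Computability.AlgebraicComplexity

open Literature.NumberTheory.DiophantineGeometry
open Literature.RepresentationTheory.GeneralLinear (schurRep stdRep symPowerRep)

/-! ### §4.3 Stability (Kempf): closed orbits under a subgroup of `GL(W)` -/

section Stability

variable {σ k : Type*} [Fintype σ] [DecidableEq σ] [Field k]

/-- The orbit `G · f` of a polynomial `f ∈ k[x_σ]` under a subgroup `G ≤ GL(W) = GL σ k` acting by
linear substitution of variables (`linSubstRep`). For `G = ⊤` this is `glOrbit`, for
`G = slSubgroup` it is `slOrbit` (`subgroupOrbit_top`, `subgroupOrbit_slSubgroup`).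
BLMW 2011 §3 ("`G ⊆ GL(V)` a subgroup. We let `G·v ⊂ V` denote the orbit of `v`").
[cite: BurgisserEtAl2011, §3] -/
def subgroupOrbit (G : Subgroup (GL σ k)) (f : MvPolynomial σ k) : Set (MvPolynomial σ k) :=
  {h | ∃ g ∈ G, h = linSubstRep σ k g f}

/-- Unfolding of `subgroupOrbit` (BLMW 2011 §3, the orbit `G·v`). [cite: BurgisserEtAl2011, §3] -/
theorem mem_subgroupOrbit_iff {G : Subgroup (GL σ k)} {f h : MvPolynomial σ k} :
    h ∈ subgroupOrbit G f ↔ ∃ g ∈ G, h = linSubstRep σ k g f :=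
  Iff.rfl

/-- `f ∈ G · f` (BLMW 2011 §3). [cite: BurgisserEtAl2011, §3] -/
theorem mem_subgroupOrbit_self (G : Subgroup (GL σ k)) (f : MvPolynomial σ k) :
    f ∈ subgroupOrbit G f :=
  ⟨1, G.one_mem, by simp⟩

/-- The orbit under all of `GL(W)` is the tree's `glOrbit` (BLMW 2011 §3, `GL(W)·v`). [cite: BurgisserEtAl2011, §3] -/
theorem subgroupOrbit_top (f : MvPolynomial σ k) : subgroupOrbit (⊤ : Subgroup (GL σ k)) f = glOrbit σ k f := by
  ext h
  simp only [mem_subgroupOrbit_iff, Subgroup.mem_top, true_and, glOrbit, Set.mem_range]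
  constructor
  · rintro ⟨g, hg⟩
    exact ⟨g, hg.symm⟩
  · rintro ⟨g, hg⟩
    exact ⟨g, hg.symm⟩

/-- The orbit under `SL(W)` (the tree's `slSubgroup`, the range of `SL σ k → GL σ k`) is the tree's
`slOrbit` (BLMW 2011 §4, `SL(W)·v`). [cite: BurgisserEtAl2011, §4.4] -/
theorem subgroupOrbit_slSubgroup (f : MvPolynomial σ k) :
    subgroupOrbit (slSubgroup σ k) f = slOrbit σ k f := by
  ext h
  simp only [mem_subgroupOrbit_iff, slSubgroup, MonoidHom.mem_range, mem_slOrbit_iff]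
  constructor
  · rintro ⟨g, ⟨s, rfl⟩, rfl⟩
    exact ⟨s, by rw [linSubstRep_apply]; rfl⟩
  · rintro ⟨s, rfl⟩
    exact ⟨Matrix.SpecialLinearGroup.toGL s, ⟨s, rfl⟩, by rw [linSubstRep_apply]; rfl⟩

/-- **`G`-stability (Kempf 1978; BLMW 2011 §4.3):** "Following Kempf, a non-zero vector `v ∈ V`
is said to be `G`-stable if the orbit `G·v` is closed." Here for a polynomial `f` (meant: a
non-zero form) and a subgroup `G ≤ GL(W)`: the set of coefficient vectors of `G · f` is Zariski
closed in coefficient space `(σ →₀ ℕ) → k` (the tree's `zariskiClosure`/`coeffVec`, as in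
`IsPolystable`; for a form of degree `d` this is closedness in `S^dW`, see `Polystability.lean`,
rendering notes). For `G = SL(W)` this is literally the tree's `IsPolystable`
(`isStableUnder_slSubgroup_iff`). BLMW 2011 §4.3 (v1: §4.3, held p0007).
[cite: BurgisserEtAl2011, §4.3] -/
def IsStableUnder (G : Subgroup (GL σ k)) (f : MvPolynomial σ k) : Prop :=
  zariskiClosure (coeffVec '' subgroupOrbit G f) ⊆ coeffVec '' subgroupOrbit G f

/-- `SL(W)`-stability in the sense of BLMW §4.3 is the tree's polystability
(Bürgisser–Ikenmeyer 2017, Def. 2.7). [cite: BurgisserEtAl2011, §4.3] -/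
theorem isStableUnder_slSubgroup_iff (f : MvPolynomial σ k) :
    IsStableUnder (slSubgroup σ k) f ↔ IsPolystable f := by
  rw [IsStableUnder, subgroupOrbit_slSubgroup]
  rfl

/-- `GL(W)`-stability unfolds to: the coefficient image of `glOrbit` is Zariski closed (BLMW 2011 §4.3). [cite: BurgisserEtAl2011, §4.3] -/
theorem isStableUnder_top_iff (f : MvPolynomial σ k) :
    IsStableUnder (⊤ : Subgroup (GL σ k)) f ↔
      zariskiClosure (coeffVec '' glOrbit σ k f) ⊆ coeffVec '' glOrbit σ k f := by
  rw [IsStableUnder, subgroupOrbit_top]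

/-! ### §4.4 `GL(W)`-orbits of forms are never stable -/

omit [DecidableEq σ] in
/-- The zero substitution kills a form of positive degree: `f(0 · x) = 0` (the step "contains the origin in its closure" of BLMW 2011 §4.4). [cite: BurgisserEtAl2011, §4.4] -/
theorem linSubst_zero_of_isHomogeneous {f : MvPolynomial σ k} {m : ℕ} (hf : f.IsHomogeneous m)
    (hm : m ≠ 0) : linSubst σ k 0 f = 0 := by
  have hX : ∀ i : σ, linSubst σ k (0 : Matrix σ σ k) (X i) = 0 := fun i => by
    rw [linSubst_X]; simp
  -- `linSubst 0` is the `k`-algebra map `X_i ↦ 0`, i.e. `aeval 0`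
  have h0 : linSubst σ k (0 : Matrix σ σ k) = aeval (fun _ : σ => (0 : MvPolynomial σ k)) := by
    apply MvPolynomial.algHom_ext
    intro i
    rw [hX i, aeval_X]
  rw [h0]
  -- a form of positive degree has no constant term, so it vanishes at `0`
  apply MvPolynomial.aeval_eq_zero
  intro d hd
  have hdeg := hf hd
  have hd0 : d ≠ 0 := by
    rintro rfl
    rw [map_zero] at hdeg
    exact hm hdeg.symm
  obtain ⟨i, hi⟩ := Finsupp.ne_iff.mp hd0
  exact ⟨i, Finsupp.mem_support_iff.mpr (by simpa using hi), rfl⟩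

/-- **The origin lies in the orbit closure of every form of positive degree** (over an infinite
field): `0 = f(0·x) ∈ End(W)·f ⊆ \overline{GL(W)·f}` (`endOrbit_subset_orbitClosure_holds`).
BLMW 2011 §4.4: "the orbit `GL(W)·v` … contains the origin in its closure".
[cite: BurgisserEtAl2011, §4.4] -/
theorem zero_mem_orbitClosure_of_isHomogeneous [Infinite k] {f : MvPolynomial σ k} {m : ℕ}
    (hf : f.IsHomogeneous m) (hm : m ≠ 0) : (0 : MvPolynomial σ k) ∈ orbitClosure f := by
  have h : (0 : MvPolynomial σ k) ∈ endOrbit σ k f :=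
    ⟨0, linSubst_zero_of_isHomogeneous hf hm⟩
  exact endOrbit_subset_orbitClosure_holds f h

/-- **A non-zero polynomial's `GL(W)`-orbit does not contain `0`** (each `g ∈ GL(W)` acts
invertibly; the other half of BLMW 2011 §4.4 "never stable"). [cite: BurgisserEtAl2011, §4.4] -/
theorem zero_notMem_glOrbit {f : MvPolynomial σ k} (hf : f ≠ 0) : (0 : MvPolynomial σ k) ∉ glOrbit σ k f := by
  rintro ⟨g, hg⟩
  have hg' : linSubstRep σ k g f = 0 := hg
  apply hf
  have : linSubstRep σ k g⁻¹ (linSubstRep σ k g f) = f := by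
    rw [← Module.End.mul_apply, ← map_mul, inv_mul_cancel, map_one, Module.End.one_apply]
  rw [← this, hg', map_zero]

/-- **BLMW 2011 §4.4, first paragraph (proved):** "Suppose that the homotheties in `GL(W)` act
non-trivially on `v`. Then the orbit `GL(W)·v` is never stable, as it contains the origin in its
closure." For a non-zero form `f` of positive degree `m` over an infinite field (homotheties act
by `t^m ≠ 1`): `f` is not `GL(W)`-stable. (v1: §4.4, held p0007.) [cite: BurgisserEtAl2011, §4.4] -/
theorem not_isStableUnder_top [Infinite k] {f : MvPolynomial σ k} {m : ℕ} (hf : f.IsHomogeneous m)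
    (hm : m ≠ 0) (hf0 : f ≠ 0) : ¬ IsStableUnder (⊤ : Subgroup (GL σ k)) f := by
  rw [isStableUnder_top_iff]
  intro h
  have h0 : coeffVec (0 : MvPolynomial σ k) ∈ zariskiClosure (coeffVec '' glOrbit σ k f) :=
    zero_mem_orbitClosure_of_isHomogeneous hf hm
  obtain ⟨p, hp, hp0⟩ := h h0
  have : p = 0 := coeffVec_injective hp0
  exact zero_notMem_glOrbit hf0 (this ▸ hp)

end Stability

/-! ### §4.1 (4.1.2) and Def. 6.1.3: invariants of a subgroup, admissibility -/

section Invariants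

variable {k G V : Type*} [CommRing k] [Group G] [AddCommGroup V] [Module k V]

/-- The space `M^H` of `H`-invariants of a `G`-module `M` for a subgroup `H ≤ G` (Mathlib's
`Representation.invariants` of the restriction `ρ|_H`). By (4.1.2)
(`ℂ[G/H] = ⊕_λ (V_λ^*)^{⊕ dim V_λ^H}`, Kraft II.3 Thm. 3) its dimension for `M = V_λ` is the
multiplicity of `V_λ^*` in the coordinate ring of the orbit `G·v ≅ G/G(v)`; this is how BLMW
compute `ℂ[GL(W)·det_n]`, `ℂ[GL(W)·per_m]` (proofs of Props. 5.2.1, 5.5.2). BLMW 2011 §4.1,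
Def. 6.1.3. [cite: BurgisserEtAl2011, §4.1 (4.1.2)] -/
def subgroupInvariants (ρ : Representation k G V) (H : Subgroup G) : Submodule k V :=
  Representation.invariants (ρ.comp H.subtype)

/-- Membership in `M^H`: fixed by every element of `H` (BLMW 2011 §4.1, `V_λ^H`). [cite: BurgisserEtAl2011, §4.1 (4.1.2)] -/
theorem mem_subgroupInvariants_iff {ρ : Representation k G V} {H : Subgroup G} {v : V} :
    v ∈ subgroupInvariants ρ H ↔ ∀ g ∈ H, ρ g v = v :=
  ⟨fun h g hg => h ⟨g, hg⟩, fun h g => h g g.2⟩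

/-- For `H = G` the subgroup invariants are Mathlib's `Representation.invariants` (BLMW 2011 §3, `V^H`). [cite: BurgisserEtAl2011, §3] -/
theorem subgroupInvariants_top (ρ : Representation k G V) :
    subgroupInvariants ρ ⊤ = ρ.invariants := by
  ext v
  simp [mem_subgroupInvariants_iff, Representation.mem_invariants]

/-- **`H`-admissible module (BLMW 2011, Def. 6.1.3 = [MS2]):** "Let `H ⊂ G` be a subgroup. We say
that a `G`-module `M` is `H`-admissible if it contains a non-zero `H`-invariant." (v1: Def. 6.3,
held p0012.) "Note that an irreducible `G`-module is `H`-admissible iff it appears in `ℂ[G/H]`"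
(by (4.1.2); not restated). [cite: BurgisserEtAl2011, Def. 6.1.3] -/
def IsAdmissible (ρ : Representation k G V) (H : Subgroup G) : Prop :=
  subgroupInvariants ρ H ≠ ⊥

/-- Unfolding: `M` is `H`-admissible iff some non-zero vector is fixed by `H`. [cite: BurgisserEtAl2011, Def. 6.1.3] -/
theorem isAdmissible_iff_exists {ρ : Representation k G V} {H : Subgroup G} :
    IsAdmissible ρ H ↔ ∃ v : V, v ≠ 0 ∧ ∀ g ∈ H, ρ g v = v := by
  rw [IsAdmissible, Submodule.ne_bot_iff]
  simp only [mem_subgroupInvariants_iff]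
  constructor
  · rintro ⟨v, hv, hv0⟩; exact ⟨v, hv0, hv⟩
  · rintro ⟨v, hv0, hv⟩; exact ⟨v, hv, hv0⟩

end Invariants

/-! ### Prop. 4.5.4: the interlacing relation `π ↦ π'` of the Pieri formula -/

/-- **The relation `π ↦ π'` of BLMW 2011, Prop. 4.5.4 (Pieri formula):** "the notation `π ↦ π'`
means that `π₁ ≥ π'₁ ≥ π₂ ≥ π'₂ ≥ ⋯ ≥ 0`" (parts padded by zeros; `π`, `π'` partitions of possibly
different sizes, `|π| - |π'|` boxes removed, at most one per column). This is the index relation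
of `S_π(A ⊕ A') = ⊕_{π ↦ π'} S_{π'}A ⊗ S^{|π|-|π'|}A'` (`dim A' = 1`) and is consumed by Def. 5.6.1
and Thm. 4.5.5. On dual weights it is the tree's `IsHorizStripOver` (`CapabilityBound.lean`).
Declared in Mathlib's `Nat.Partition` namespace for dot notation (deliberate extension, tree
convention as `Nat.Partition.sortedParts`). (v1: Prop. 4.5, held p0008.)
[cite: BurgisserEtAl2011, Prop. 4.5.4] -/
def _root_.Nat.Partition.Interlaces {a b : ℕ} (π : Nat.Partition a) (π' : Nat.Partition b) : Prop :=
  ∀ i : ℕ, π'.sortedParts.getD i 0 ≤ π.sortedParts.getD i 0 ∧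
    π.sortedParts.getD (i + 1) 0 ≤ π'.sortedParts.getD i 0

/-! ### (5.2.5) Symmetric Kronecker coefficients -/

section SymKronecker

variable (k : Type*) [Field k] {d : ℕ}

/-- **The symmetric Kronecker coefficient (BLMW 2011, (5.2.5)):**
"`sk^π_{μμ} := dim Hom_{𝔖_d}([π], Sym²[μ])`. So `sk^π_{μμ}` equals the multiplicity of `[π]` in the
symmetric square `Sym²[μ]`." Here `[π]` = the Specht module `spechtRep k π`, `Sym²[μ]` =
`symPowerRep (spechtRep k μ) 2` (the image of the symmetrizer on `[μ] ⊗ [μ]`, `SchurFunctor.lean`),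
and `Hom_{𝔖_d}` = Mathlib's `Representation.IntertwiningMap`. The tree's `symKroneckerCoeffRect k n δ π`
(`DetOrbitSymKroneckerBound.lean`) is the rectangular case `μ = δⁿ` defined through a bound space
and identified with `sk` there by its character formula; the two are not syntactically equal.
(v1: absent — v1 used `k_{πμμ}`.) [cite: BurgisserEtAl2011, §5.2 (5.2.5)] -/
def symKroneckerCoeff (π μ : Nat.Partition d) : ℕ :=
  Module.finrank k ((spechtRep k π).IntertwiningMap (symPowerRep (spechtRep k μ) 2))

/-- **"Note that `sk^π_{μμ} ≤ k_{πμμ}` and the inequality may be strict"** (BLMW 2011, after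
(5.2.5); `Sym²[μ] ⊂ [μ] ⊗ [μ]`). With the tree's `kroneckerCoeff k μ μ π = dim Hom([μ] ⊗ [μ], [π])`
(`= dim Hom([π], [μ] ⊗ [μ]) = k_{πμμ}` over `ℂ`). Named fact (D-0014), stated over `ℂ` as printed.
[cite: BurgisserEtAl2011, §5.2 (after (5.2.5))] -/
def BLMW2011_symKroneckerCoeff_le : Prop :=
  ∀ {d : ℕ} (π μ : Nat.Partition d), symKroneckerCoeff ℂ π μ ≤ kroneckerCoeff ℂ μ μ π

end SymKronecker

/-! ### Prop. 5.2.1: the `GL(W)`-orbit ring of `det_n` -/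

section DetOrbit

/-- **BLMW 2011, Prop. 5.2.1, (5.2.6) via (4.1.2) — the orbit ring of the determinant:**
"`ℂ[GL(W)·det_n] = ⊕_{δ ≥ 0} ⊕_{π : |π| = nδ} (S_πW^*)^{⊕ sk^π_{δⁿδⁿ}}`" (`W = E ⊗ F ≅ Mat_{n×n}`,
`E = F = ℂⁿ`), established in the proof as "`dim (S_π(E ⊗ F))^H = sk^π_{δⁿδⁿ}` … Moreover, if `n`
does not divide `|π|`, then `(S_π(E ⊗ F))^{H₀} = 0`", `H = GL(W)(det_n)` the stabilizer (5.2.1)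
(Frobenius; tree: `frobenius_detPreserver_unimodular_sandwich`), the multiplicity of `S_πW^*` in
`ℂ[GL(W)·det_n] = ℂ[GL(W)]^{H}` being `dim (S_πW)^H` by (4.1.2). Typed clause: for every `n, δ`
and `π ⊢ nδ` with `ℓ(π) ≤ n²` (so that `S_πW ≠ 0` indexes a `GL(W)`-module), the space of
`linStabilizer (det_n)`-invariants of `S_πW = schurRep (stdRep (MatIdx n) ℂ) π` has dimension
`sk^π_{δⁿδⁿ} = symKroneckerCoeff ℂ π (δⁿ)`; and it is `0` whenever `n ∤ |π|`.
The CLOSURE inclusion (5.2.7) is the tree's PROVED `orbitMultiplicity_det_le_symKroneckerCoeffRect`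
and is not restated. Named fact (D-0014). (v1: Prop. 5.1 with `k` in place of `sk`, held p0009.)
[cite: BurgisserEtAl2011, Prop. 5.2.1 (5.2.6)] -/
def BLMW2011_prop_5_2_1_invariants : Prop :=
  (∀ (n δ : ℕ) (π : Nat.Partition (n * δ)), π.parts.card ≤ n * n →
    Module.finrank ℂ (subgroupInvariants (schurRep (stdRep (MatIdx n) ℂ) π)
      (linStabilizer (detFormLex ℂ n))) = symKroneckerCoeff ℂ π (Nat.Partition.rectangle n δ)) ∧
  ∀ (n D : ℕ) (π : Nat.Partition D), ¬ n ∣ D →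
    subgroupInvariants (schurRep (stdRep (MatIdx n) ℂ) π) (linStabilizer (detFormLex ℂ n)) = ⊥

end DetOrbit

/-! ### Def. 5.5.1, Prop. 5.5.2: the `GL(W)`-orbit ring of `per_m` -/

namespace BLMW2011

variable (k : Type*) [Field k]

open Classical in
/-- **BLMW 2011, Def. 5.5.1 (`Σ_{per_m}`):** "Define `Σ_{per_m} ⊂ Λ⁺_{GL_{m²}}` to be the set of
partitions `π` such that: 1. `|π| = δm` some `δ ∈ ℕ`, 2. there exist `μ, ν ⊢_m δm` with `p_μ p_ν ≠ 0`
and either (a) `k_{πμν} ≠ 0` if `μ ≠ ν` or (b) `sk^π_{μμ} ≠ 0` if `μ = ν`", where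
`p_μ := dim (S_μE)_0^{𝔚_E} = mult(S_μE, S^m(S^δE))` (Cor. 8.4.2; the tree's
`plethysmCoeffOfPartition k m δ μ`) and `⊢_m` = at most `m` parts. Typed as a predicate on
`π ⊢ mδ` (condition 1 is carried by the type; a partition of a number not divisible by `m` is not
in `Σ_{per_m}`) with `ℓ(π) ≤ m²` (`π ∈ Λ⁺_{GL_{m²}}`). (v1: Def. 5.2 with `k` only, held p0010.)
Typed AS PRINTED. (ERRATUM note, see the module docstring: with the corrected `mult_π` the support
of `ℂ[GL(W)·per_m]` is `{π : mult_π ≠ 0}`, which contains `Σ_{per_m}` and may exceed it by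
partitions `π` whose only invariants come from the omitted summand — `p_μ ≥ 2`, `[π] ⊂ Λ²[μ]`,
`sk^π_{μμ} = 0`; no such `π` occurs for `(m, δ) ∈ {(3,6), (4,4), (5,3)}`. Junk note (ERRATUM
A19): at `δ = 0` the tree's `p_∅ = plethysmCoeffOfPartition k m 0 ∅` is the `finrank` junk `0`, so
`∅ ∉ Σ_{per_m}` as typed although in print `p_∅ = 1`; the three named facts below exclude `δ = 0`.)
[cite: BurgisserEtAl2011, Def. 5.5.1] -/
def MemSigmaPer (m δ : ℕ) (π : Nat.Partition (m * δ)) : Prop :=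
  π.parts.card ≤ m * m ∧
    ∃ μ ν : Nat.Partition (m * δ), μ.parts.card ≤ m ∧ ν.parts.card ≤ m ∧
      plethysmCoeffOfPartition k m δ μ * plethysmCoeffOfPartition k m δ ν ≠ 0 ∧
      ((μ ≠ ν ∧ kroneckerCoeff k μ ν π ≠ 0) ∨ (μ = ν ∧ symKroneckerCoeff k π μ ≠ 0))

open Classical in
/-- The finite set of partitions `μ ⊢_m mδ` (at most `m` parts) over which Def. 5.5.1 sums.
[cite: BurgisserEtAl2011, Def. 5.5.1] -/
def partsLE (m δ : ℕ) : Finset (Nat.Partition (m * δ)) :=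
  Finset.univ.filter fun μ => μ.parts.card ≤ m

open Classical in
/-- **Twice BLMW's `mult_π` AS PRINTED (Def. 5.5.1)**, division-free:
`2·mult_π = ∑_{μ ≠ ν} k_{πμν} p_μ p_ν + 2 ∑_μ sk^π_{μμ} C(p_μ + 1, 2)`, the sums over
`μ, ν ⊢_m mδ` (ordered pairs in the first sum). [cite: BurgisserEtAl2011, Def. 5.5.1] -/
def multPerTwice (m δ : ℕ) (π : Nat.Partition (m * δ)) : ℕ :=
  (∑ μ ∈ partsLE m δ, ∑ ν ∈ partsLE m δ,
      if μ ≠ ν then kroneckerCoeff k μ ν π * plethysmCoeffOfPartition k m δ μ *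
        plethysmCoeffOfPartition k m δ ν else 0) +
    2 * ∑ μ ∈ partsLE m δ, symKroneckerCoeff k π μ * Nat.choose (plethysmCoeffOfPartition k m δ μ + 1) 2

/-- **BLMW 2011, Def. 5.5.1 (`mult_π`) AS PRINTED:** "For `π ∈ Σ_{per_m}`, define
`mult_π = ½ ∑_{μ ≠ ν} k_{πμν} p_μ p_ν + ∑_μ sk^π_{μμ} C(p_μ + 1, 2)`." Typed as
`multPerTwice / 2`; the first sum runs over ordered pairs and is even by the symmetry
`k_{πμν} = k_{πνμ}` (tree: `kroneckerCoeff_comm₁₂_holds`), so no truncation occurs in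
characteristic zero (documented junk otherwise). "Note that `mult_π ≥ 1` for `π ∈ Σ_{per_m}`."
This is the PRINTED value; the count the printed proof of Prop. 5.5.2 actually yields is
`multPer = multPerPrinted + multPerOmitted` (ERRATUM, module docstring).
[cite: BurgisserEtAl2011, Def. 5.5.1] -/
def multPerPrinted (m δ : ℕ) (π : Nat.Partition (m * δ)) : ℕ :=
  multPerTwice k m δ π / 2

open Classical in
/-- **The summand omitted in the printed proof of BLMW 2011, Prop. 5.5.2** (ERRATUM, module
docstring): `∑_{μ ⊢_m mδ} C(p_μ, 2) · (k_{πμμ} - sk^π_{μμ})`, the dimension of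
`⊕_μ Λ²(X_μ) ⊗ (K^π_{μμ})^{-}` (`(K^π_{μμ})^{-} = Hom_{𝔖_d}([π], Λ²[μ])`, of dimension
`k_{πμμ} - sk^π_{μμ}`; `sk^π_{μμ} ≤ k_{πμμ}`, so the truncated subtraction in `ℕ` is exact —
tree: `BLMW2011_symKroneckerCoeff_le_holds`). Zero whenever every `p_μ ≤ 1`.
[cite: BurgisserEtAl2011, Prop. 5.5.2 (proof, (le:tau-action))] -/
def multPerOmitted (m δ : ℕ) (π : Nat.Partition (m * δ)) : ℕ :=
  ∑ μ ∈ partsLE m δ, Nat.choose (plethysmCoeffOfPartition k m δ μ) 2 *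
    (kroneckerCoeff k μ μ π - symKroneckerCoeff k π μ)

/-- **`mult_π`, CORRECTED (BLMW 2011, Def. 5.5.1 with the ERRATUM of the module docstring):** the
dimension of `(S_π(E ⊗ F))^{N_E × N_F, τ}` that the printed proof of Prop. 5.5.2 yields once the
omitted summand `Λ²(X_μ) ⊗ (K^π_{μμ})^{-}` is restored,
`mult_π = ½ ∑_{μ ≠ ν} k_{πμν} p_μ p_ν + ∑_μ [sk^π_{μμ} C(p_μ + 1, 2) + (k_{πμμ} - sk^π_{μμ}) C(p_μ, 2)]`
= `multPerPrinted + multPerOmitted`. It agrees with the printed `mult_π` whenever all `p_μ ≤ 1`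
(e.g. `m = 3`, `δ ≤ 5`) and exceeds it otherwise in general (`m = 3`, `δ = 6`, `π = (16,1,1)`:
`72` vs `71`). The first landing of this file (p417934) defined `multPer` as the printed value
(now `multPerPrinted`). [cite: BurgisserEtAl2011, Def. 5.5.1, Prop. 5.5.2 (proof)] -/
def multPer (m δ : ℕ) (π : Nat.Partition (m * δ)) : ℕ :=
  multPerPrinted k m δ π + multPerOmitted k m δ π

/-- Unfolding: the corrected `mult_π` is the printed one plus the omitted summand.
[cite: BurgisserEtAl2011, Def. 5.5.1] -/
theorem multPer_eq (m δ : ℕ) (π : Nat.Partition (m * δ)) :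
    multPer k m δ π = multPerTwice k m δ π / 2 + multPerOmitted k m δ π := rfl

/-- The printed `mult_π` never exceeds the corrected one. [cite: BurgisserEtAl2011, Def. 5.5.1] -/
theorem multPerPrinted_le_multPer (m δ : ℕ) (π : Nat.Partition (m * δ)) :
    multPerPrinted k m δ π ≤ multPer k m δ π :=
  Nat.le_add_right _ _

/-- When every `p_μ ≤ 1` (`μ ⊢_m mδ`) the omitted summand vanishes and the corrected `mult_π`
is the printed one. [cite: BurgisserEtAl2011, Def. 5.5.1] -/
theorem multPer_eq_multPerPrinted_of_forall_le_one {m δ : ℕ} (π : Nat.Partition (m * δ))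
    (h : ∀ μ ∈ partsLE m δ, plethysmCoeffOfPartition k m δ μ ≤ 1) :
    multPer k m δ π = multPerPrinted k m δ π := by
  rw [multPer, Nat.add_eq_left, multPerOmitted]
  refine Finset.sum_eq_zero fun μ hμ => ?_
  rw [Nat.choose_eq_zero_of_lt (Nat.lt_succ_of_le (h μ hμ)), zero_mul]

open Classical in
/-- **BLMW 2011, Def. 5.6.1 (`Σ^n_{per_m}`):** "For `n > m`, define `Σ^n_{per_m} ⊂ Λ⁺_{GL_{n²}}` to be
the set of partitions `π` such that: 1. `|π| = δn` some `δ ∈ ℕ`, 2. there exists `π' ∈ Σ_{per_m}`,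
such that `|π'| = δm` and `π ↦ π'`" (`π ↦ π'` the interlacing relation of Prop. 4.5.4,
`Nat.Partition.Interlaces`). Typed on `π ⊢ nδ` with `ℓ(π) ≤ n²`. (v1: Def. 5.4, held p0010.)
[cite: BurgisserEtAl2011, Def. 5.6.1] -/
def MemSigmaPerPadded (m n δ : ℕ) (π : Nat.Partition (n * δ)) : Prop :=
  π.parts.card ≤ n * n ∧ ∃ π' : Nat.Partition (m * δ), MemSigmaPer k m δ π' ∧ π.Interlaces π'

open Classical in
/-- **BLMW 2011, Def. 5.6.1 (`mult^n_π`):** "for `π ∈ Σ^n_{per_m}` we set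
`mult^n_π = ∑_{π' ∈ Σ_{per_m}, π ↦ π', n|π'| = m|π|} mult_{π'}`." For `π ⊢ nδ` the condition
`n|π'| = m|π|` reads `π' ⊢ mδ`. The summands are the CORRECTED `mult_{π'}` (`multPer`; ERRATUM,
module docstring), and the sum runs over ALL `π' ⊢ mδ` with `π ↦ π'`: with the printed `mult_{π'}`
(`multPerPrinted`, which vanishes exactly when condition 2 of Def. 5.5.1 fails) this is the printed sum; with
the corrected one it is what the printed derivation of Prop. 5.6.2 ("Proposition 5.5.2 and
Example 5.4 show") yields, the restriction to `π' ∈ Σ_{per_m}` being dropped for the reason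
recorded at `MemSigmaPer`. (First landing p417934: filter `π' ∈ Σ_{per_m}`, printed `mult`.)
[cite: BurgisserEtAl2011, Def. 5.6.1] -/
def multPerPadded (m n δ : ℕ) (π : Nat.Partition (n * δ)) : ℕ :=
  ∑ π' ∈ (Finset.univ : Finset (Nat.Partition (m * δ))).filter (fun π' => π.Interlaces π'),
    multPer k m δ π'

end BLMW2011

section PerOrbit

/-- **BLMW 2011, Prop. 5.5.2, (5.5.2) via (4.1.2) — the orbit ring of the permanent:**
"`ℂ[GL(W)·per_m] = ⊕_{π ∈ Σ_{per_m}} (S_πW^*)^{⊕ mult_π}`" (`W = E ⊗ F = Mat_{m×m}`, `m > 2` for the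
stabilizer (5.5.1) `GL(W)(per_m) = N ≅ (N_E × N_F)/μ_m ⋊ ℤ₂` of Marcus–May; tree:
`marcusMay1962_perPreserver_sandwich`, proved), established in the proof as "we need to show that
`dim S_π(W)^{GL(W)(per_m)} = mult_π`". Typed clause: for `m ≥ 3`, every `δ` and every `π ⊢ mδ` with
`ℓ(π) ≤ m²`, `dim (S_πW)^{GL(W)(per_m)} = mult_π`, and the invariants vanish when `m ∤ |π|` (this
second conjunct is PROVED: `BLMW2011_prop_5_5_2_invariants_right`, `BLMW11DegreeDivisibilityProofs.lean`);
`per_m` on the `m × m` matrix letters is the tree's `paddedPerFormLex ℂ m m` (no padding when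
`n = m`). **AS PROVED, not as printed (ERRATUM, module docstring):** `mult_π` here is the CORRECTED
count `BLMW2011.multPer = multPerPrinted + multPerOmitted`; with the printed `mult_π`
(`BLMW2011.multPerPrinted`, the rendering of the first landing p417934) the first conjunct is false
in general (e.g. `m = 3`, `δ = 6`, `π = (16,1,1)`: `72 ≠ 71`). **Degree guard (ERRATUM A19, module
docstring):** the first conjunct is typed for `0 < δ`; AS TYPED before (all `δ`) it failed at `δ = 0`,
where `BLMW2011.multPer ℂ m 0 ∅` is the junk value `0` but `dim (S_∅W)^{GL(W)(per_m)} = 1`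
(`BLMW11PerOrbitDegreeZero.lean`). Named fact (D-0014).
(v1: Prop. 5.3 with `k` only, held p0010.) [cite: BurgisserEtAl2011, Prop. 5.5.2 (5.5.2)] -/
def BLMW2011_prop_5_5_2_invariants : Prop :=
  (∀ (m δ : ℕ) [NeZero m] (π : Nat.Partition (m * δ)), 3 ≤ m → 0 < δ → π.parts.card ≤ m * m →
    Module.finrank ℂ (subgroupInvariants (schurRep (stdRep (MatIdx m) ℂ) π)
      (linStabilizer (paddedPerFormLex ℂ m m))) = BLMW2011.multPer ℂ m δ π) ∧
  ∀ (m D : ℕ) [NeZero m] (π : Nat.Partition D), 3 ≤ m → ¬ m ∣ D →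
    subgroupInvariants (schurRep (stdRep (MatIdx m) ℂ) π) (linStabilizer (paddedPerFormLex ℂ m m)) = ⊥

/-- **BLMW 2011, Prop. 5.5.2, (5.5.3) — the orbit CLOSURE of the permanent:**
"`ℂ[\overline{GL(W)·per_m}]_δ ⊆ ⊕_{π ∈ Σ_{per_m}, |π| = δm} (S_πW^*)^{⊕ mult_π}`" ("immediate as
`ℂ[\overline{GL(W)·per_m}]_δ ⊆ ℂ[GL(W)·per_m]_δ`"). In the tree's multiplicity form (as the
determinant twin `orbitMultiplicity_det_le_symKroneckerCoeffRect`): for `m ≥ 3`, `π ⊢ mδ` with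
`ℓ(π) ≤ m²`, the multiplicity of the dual weight `π^*` (`Weight.dualOfPartition (m·m) π`, transported to
`MatIdx m`) in `ℂ[Δ_m(per_m)]` is at most `mult_π`. **AS PROVED (ERRATUM, module docstring):**
`mult_π` = the CORRECTED `BLMW2011.multPer`; with the printed `mult_π` (`multPerPrinted`, first
landing p417934) the inclusion is not established by the printed argument (its truth is not
decided here), and "in particular zero for `π ∉ Σ_{per_m}`" is asserted only in the corrected form
`multPer π = 0 ⇒ multiplicity 0`. **Degree guard (ERRATUM A19, module docstring):** typed for
`0 < δ`; AS TYPED before (all `δ`) it failed at `δ = 0` (the constants give multiplicity `1`, the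
typed bound `BLMW2011.multPer ℂ m 0 ∅` is the junk `0`; `BLMW11PerOrbitDegreeZero.lean`). Named fact
(D-0014). (v1: Prop. 5.3 (ii), held p0010.) [cite: BurgisserEtAl2011, Prop. 5.5.2 (5.5.3)] -/
def BLMW2011_prop_5_5_2_closure : Prop :=
  ∀ (m δ : ℕ) [NeZero m] (π : Nat.Partition (m * δ)), 3 ≤ m → 0 < δ → π.parts.card ≤ m * m →
    orbitMultiplicity ℂ (paddedPerFormLex ℂ m m) m (Weight.dualOfPartition (m * m) π).toMatIdx ≤
      BLMW2011.multPer ℂ m δ π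

/-- **BLMW 2011, Prop. 5.6.2, (5.6.2) — the orbit closure of the padded permanent:**
"`ℂ[\overline{GL(W)·ℓ^{n-m}per_m}]_δ ⊆ ⊕_{π ∈ Σ^n_{per_m}, |π| = nδ} (S_πW^*)^{⊕ mult^n_π}`"
(`W = A ⊕ A' ⊕ B`, `dim W = n²`, `n > m`; the first display of Prop. 5.6.2 is the orbit-ring
equality). In the tree's multiplicity form: for `3 ≤ m < n`, `π ⊢ nδ` with `ℓ(π) ≤ n²`, the
multiplicity of `π^*` in `ℂ[Δ_n(x₀₀^{n-m} per_m)]` (the tree's `paddedPerFormLex ℂ m n`, padding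
variable `x₀₀` outside the `m × m` block) is at most `mult^n_π`. **AS PROVED (ERRATUM, module
docstring):** `mult^n_π` = `BLMW2011.multPerPadded` with the CORRECTED `mult_{π'}` summed over all
interlacing `π'`; with the printed `mult_{π'}` the inclusion is not established by the printed
argument. **Degree guard (ERRATUM A19, module docstring):** typed for `0 < δ`; AS TYPED before (all
`δ`) it failed at `δ = 0` (`BLMW2011.multPerPadded ℂ m n 0 ∅ = 0`, junk, against the constants'
multiplicity `1`; `BLMW11PerOrbitDegreeZero.lean`, `multPerPadded_zero_eq_zero`). Named fact (D-0014).
(v1: Prop. 5.5 (ii), held p0010–p0011.) [cite: BurgisserEtAl2011, Prop. 5.6.2 (5.6.2)] -/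
def BLMW2011_prop_5_6_2_closure : Prop :=
  ∀ (m n δ : ℕ) [NeZero n] (π : Nat.Partition (n * δ)), 3 ≤ m → m < n → 0 < δ → π.parts.card ≤ n * n →
    orbitMultiplicity ℂ (paddedPerFormLex ℂ m n) n (Weight.dualOfPartition (n * n) π).toMatIdx ≤
      BLMW2011.multPerPadded ℂ m n δ π

end PerOrbit

/-! ### §6.3 The subspace variety `Sub_a(S^dW)` and Prop. 6.3.1(1) -/

section Subspace

variable {σ k : Type*} [Fintype σ] [DecidableEq σ] [Field k]

/-- **The subspace variety (BLMW 2011 §6.3):**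
"`Sub_a(S^dW) = {f ∈ S^dW | ∃ W' ⊂ W, dim W' = a, f ∈ S^dW' ⊂ S^dW}`": forms of degree `d` that can
be written in `a` linear forms, i.e. some `GL(W)`-translate involves at most `a` of the variables
(`W'` = the span of those variables after the change of coordinates). Its ideal is the tree's
`subVanishingIdeal` (`CapabilityBound.lean`, for the coordinate subspace of the top letters).
(v1: §6.3, held p0013.) [cite: BurgisserEtAl2011, §6.3] -/
def subspaceVariety (σ k : Type*) [Fintype σ] [DecidableEq σ] [Field k] (a d : ℕ) :
    Set (MvPolynomial σ k) :=
  {f | f.IsHomogeneous d ∧ ∃ g : GL σ k, ∃ S : Finset σ, S.card ≤ a ∧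
    ↑((linSubstRep σ k g f).vars) ⊆ (S : Set σ)}

/-- A form in at most `a` variables lies in `Sub_a`. [cite: BurgisserEtAl2011, §6.3] -/
theorem mem_subspaceVariety_of_card_vars_le {a d : ℕ} {f : MvPolynomial σ k} (hf : f.IsHomogeneous d)
    (ha : f.vars.card ≤ a) : f ∈ subspaceVariety σ k a d :=
  ⟨hf, 1, f.vars, ha, by simp⟩

variable {τ : Type*} [Fintype τ] [LinearOrder τ] [LinearOrder σ]

/-- **BLMW 2011, Prop. 6.3.1 (1) ([Weyman] §7.2), the half not yet in the tree:** "The ideal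
`I(Sub_a(S^dW))` is the span of all submodules `S_πW^*` in `Sym(S^dW^*)` for which `ℓ(π) > a`."
The tree has `I(Sub_a)` as `subVanishingIdeal k ι m` for the inclusion `ι : σ → τ` of the top
`a = |σ|` letters and PROVES "`ℓ(π) > a` ⇒ `S_πW^* ⊂ I(Sub_a)`" for highest-weight vectors
(`highestWeightSpace_le_subVanishingIdeal`). Typed here is the complementary clause: a
highest-weight vector of `k[S^mW]` (`coordRep`) whose weight `ψ` is supported on `range ι`
(type `π` with `ℓ(π) ≤ a`) lies in `I(Sub_a)` only if it is zero. Named fact (D-0014), over `ℂ`.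
(v1: Prop. 6.7, held p0013.) [cite: BurgisserEtAl2011, Prop. 6.3.1 (1)] -/
def BLMW2011_prop_6_3_1_i_inf_eq_bot : Prop :=
  ∀ {σ τ : Type} [Fintype σ] [LinearOrder σ] [Fintype τ] [LinearOrder τ] (ι : σ → τ),
    StrictMono ι → IsUpperSet (Set.range ι) → ∀ {m : ℕ}, m ≠ 0 → ∀ (ψ : Weight τ),
    (∀ x, x ∉ Set.range ι → ψ x = 0) →
      highestWeightSpace (coordRep τ ℂ m) ψ ⊓ (subVanishingIdeal ℂ ι m).restrictScalars ℂ = ⊥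

end Subspace

/-! ### §6.4 Polynomials divisible by a power of a linear form: `F_s(S^dW)` -/

section LinearPower

variable {σ k : Type*} [Fintype σ] [DecidableEq σ] [Field k]

/-- **`F_s(S^dW)` (BLMW 2011 §6.4):** "`F_s(S^dW) = {f ∈ S^dW | f = ℓ^s g` for some `ℓ ∈ W`,
`g ∈ S^{d-s}W}`" — forms of degree `d` divisible by the `s`-th power of a linear form (`ℓ` a form of
degree `1`, `g` a form of degree `d - s`; meaningful for `s ≤ d`). (v1: §6.4, held p0014.)
[cite: BurgisserEtAl2011, §6.4] -/
def linearPowerMultiples (σ k : Type*) [Fintype σ] [DecidableEq σ] [Field k] (s d : ℕ) :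
    Set (MvPolynomial σ k) :=
  {f | ∃ ℓ g : MvPolynomial σ k, ℓ.IsHomogeneous 1 ∧ g.IsHomogeneous (d - s) ∧ f = ℓ ^ s * g}

/-- The `GL(W)`-orbit of a padded form `x_t^s · g` (`g` of degree `d - s`) lies in `F_s(S^dW)`:
a linear substitution maps `x_t` to a linear form and `g` to a form of the same degree.
BLMW 2011 §6.4 ("one is interested in … `\overline{GL(W)·ℓ^{n-m}per_m}` which is contained in
`F_{n-m}(S^nW)`", orbit part). [cite: BurgisserEtAl2011, §6.4] -/
theorem glOrbit_X_pow_mul_subset_linearPowerMultiples {s d : ℕ} (t : σ) {g : MvPolynomial σ k}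
    (hg : g.IsHomogeneous (d - s)) :
    glOrbit σ k (X t ^ s * g) ⊆ linearPowerMultiples σ k s d := by
  rintro _ ⟨A, rfl⟩
  refine ⟨linSubst σ k (A : Matrix σ σ k) (X t), linSubst σ k (A : Matrix σ σ k) g,
    linSubst_isHomogeneous _ (isHomogeneous_X k t), linSubst_isHomogeneous _ hg, ?_⟩
  change linSubstRep σ k A (X t ^ s * g) = _
  rw [linSubstRep_apply, map_mul, map_pow]

/-- **"The closed subvariety `F_s(S^dW)`" (BLMW 2011 §6.4):** the set of forms of degree `d`
divisible by the `s`-th power of a linear form is Zariski closed (it is the image of the vector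
bundle `S^s𝒮^* ⊗ S^{d-s}W^*` over `ℙW`, a proper map — the desingularisation used in §6.4). Typed:
for `s ≤ d`, over `ℂ` and finitely many variables, the coefficient image of `F_s(S^dW)` is Zariski
closed in coefficient space. Named fact (D-0014). [cite: BurgisserEtAl2011, §6.4] -/
def BLMW2011_linearPowerMultiples_closed : Prop :=
  ∀ {σ : Type} [Fintype σ] [DecidableEq σ] (s d : ℕ), s ≤ d →
    zariskiClosure (coeffVec '' linearPowerMultiples σ ℂ s d) ⊆ coeffVec '' linearPowerMultiples σ ℂ s d

/-- **Corollary (BLMW 2011 §6.4, closure part):** "`\overline{GL(W)·ℓ^{n-m}per_m}` … is contained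
in `F_{n-m}(S^nW)`" — for any form `g` of degree `d - s` and padding letter `t`, the orbit CLOSURE
of `x_t^s g` lies in `F_s(S^dW)`, from the closedness fact. [cite: BurgisserEtAl2011, §6.4] -/
theorem orbitClosure_X_pow_mul_subset_linearPowerMultiples (h : BLMW2011_linearPowerMultiples_closed)
    {σ : Type} [Fintype σ] [DecidableEq σ] {s d : ℕ} (hsd : s ≤ d) (t : σ) {g : MvPolynomial σ ℂ}
    (hg : g.IsHomogeneous (d - s)) :
    orbitClosure (X t ^ s * g) ⊆ linearPowerMultiples σ ℂ s d := by
  intro f hf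
  have h1 : coeffVec f ∈ zariskiClosure (coeffVec '' linearPowerMultiples σ ℂ s d) :=
    zariskiClosure_mono (Set.image_mono (glOrbit_X_pow_mul_subset_linearPowerMultiples t hg)) hf
  obtain ⟨p, hp, hpf⟩ := h s d hsd h1
  rwa [← coeffVec_injective hpf]

end LinearPower

/-! ### Prop. 4.5.4 (Pieri formula), character form -/

section Pieri

open Literature.RingTheory.SymmetricFunctions (SymmPoly.schur)

open Classical in
/-- **BLMW 2011, Prop. 4.5.4 (Pieri formula; [Weyman] Prop. 2.3.1), character form:** "For
`dim A' = 1`, one has the `GL(A) × GL(A')`-module decomposition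
`S_π(A ⊕ A') = ⊕_{π ↦ π'} S_{π'}A ⊗ S^{|π|-|π'|}A'`, where the notation `π ↦ π'` means that
`π₁ ≥ π'₁ ≥ π₂ ≥ π'₂ ≥ ⋯ ≥ 0`." Taking characters (`GL(A) × GL(A')` acting through the torus
`diag(x₁,…,x_N, y)`, `dim A = N`), this is the branching rule of Schur polynomials
`s_π(x₁,…,x_N,y) = ∑_{π ↦ π'} s_{π'}(x₁,…,x_N) · y^{|π|-|π'|}` (Macdonald I §5 (5.16)), typed with the
tree's Jacobi–Trudi `SymmPoly.schur` for `π` a partition with at most `N + 1` parts (an antitone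
`Fin (N+1) → ℕ`), the sum over the `π' : Fin N → ℕ` interlacing `π` (`π'_i ≤ π_i`, `π_{i+1} ≤ π'_i`;
all `π'_i ≤ π₁`, a finite set), in any commutative ring. (The module statement itself needs
highest-weight theory for the Levi `GL(A) × GL(A')`, not in the tree; in characteristic zero it is
equivalent to this identity of characters.) Named fact (D-0014). (v1: Prop. 4.5, held p0008.)
[cite: BurgisserEtAl2011, Prop. 4.5.4] -/
def BLMW2011_prop_4_5_4_character : Prop :=
  ∀ {R : Type} [CommRing R] {N : ℕ} (x : Fin N → R) (y : R) (la : Fin (N + 1) → ℕ), Antitone la →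
    SymmPoly.schur (Fin.snoc x y) la =
      ∑ mu ∈ (Fintype.piFinset fun _ : Fin N => Finset.range (la 0 + 1)) with
          (∀ i : Fin N, mu i ≤ la (Fin.castSucc i) ∧ la (Fin.succ i) ≤ mu i),
        SymmPoly.schur x mu * y ^ (∑ i, la i - ∑ i, mu i)

end Pieri

end Literature.Computability.AlgebraicComplexity
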